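import Mathlib
import HarnessLib

/-!
# Ball–Rivoal series, I: partial fractions of products of "bricks"

Topic `Literature/NumberTheory/Transcendental`. Elementary bookkeeping for the arithmetic part
of Rivoal's proof of the Ball–Rivoal theorem (`PeriodsWave0.lean`, **periods.S19**,
`Literature.NumberTheory.Transcendental.ball_rivoal`; [Rivoal2000, §2, Lemme 1 and Lemme 5]).
Rivoal's rational function
`R_n(t) = n!^{a-2r} (t-rn+1)_{rn} (t+n+2)_{rn} / (t+1)_{n+1}^a` is a product of `a` *bricks*,
each of the shape `P(t)/(t+1)_{n+1}` with `deg P ≤ n`, i.e. (Lagrange) of the shape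
`B(t) = ∑_{m=0}^{n} A_m/(t+m+1)` with *integer* residues `A_m` ([Rivoal2000, proof of Lemme 5]:
"on décompose le numérateur de `R_n(t)` en `2r` produits de `n` facteurs consécutifs …
`F_l`, `G_l`, `H`"). This file proves, by induction on the number `K` of bricks, that such a
product has a partial fraction expansion

`∏_{s<K} B_s(t) = ∑_{p=0}^{n} ∑_{o<K} c_{o,p} / (t+p+1)^{o+1}`      (`pfEval`)

whose coefficients satisfy `d^{K-1-o} c_{o,p} ∈ ℤ` for any common multiple `d` of `1, …, n`
(`IsInt`; with `d = d_n = lcm(1,…,n)` this is the mechanism of [Rivoal2000, Lemme 5]) and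
`∑ |c_{o,p}| ≤ K! ∏_s ∑_m |A^{(s)}_m|` (`l1`; this replaces the Cauchy-formula estimate of
[Rivoal2000, Lemme 4] by an elementary one) — `exists_pf_prod`. The only algebraic input is the
expansion of `1/(x^{i+1}(x+δ))` in partial fractions (`basic_identity`).

Everything here is PROVED; there are no named facts. Continued in `BallRivoalSeries.lean`.

## References

* [Rivoal2000] T. Rivoal, C. R. Acad. Sci. Paris Sér. I 331 (2000) 267–270, arXiv:math/0008051,
  §2 (Lemmes 1, 4, 5).
-/

noncomputable section

open Finset

namespace Literature.NumberTheory.Transcendental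

namespace BallRivoal

/-! ### Partial-fraction data and their evaluation -/

/-- Evaluation of partial-fraction data `c` (coefficient `c o p` of `1/(t+p+1)^{o+1}`, poles
`-1, …, -(n+1)`, orders `1, …, K`) at `t`. [folklore] -/
def pfEval (n K : ℕ) (c : ℕ → ℕ → ℚ) (t : ℚ) : ℚ :=
  ∑ p ∈ range (n + 1), ∑ o ∈ range K, c o p / (t + p + 1) ^ (o + 1)

/-- A *brick*: `∑_{m=0}^{n} A_m/(t+m+1)` with integer residues `A_m`. [folklore] -/
def brickEval (n : ℕ) (A : ℕ → ℤ) (t : ℚ) : ℚ :=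
  ∑ m ∈ range (n + 1), (A m : ℚ) / (t + m + 1)

/-- `ℓ¹`-norm of partial-fraction data on its support. [folklore] -/
def l1 (n K : ℕ) (c : ℕ → ℕ → ℚ) : ℚ :=
  ∑ p ∈ range (n + 1), ∑ o ∈ range K, |c o p|

/-- Integrality of partial-fraction data: `d^{K-1-o} c_{o,p} ∈ ℤ` for all `o, p`. [folklore] -/
def IsInt (K : ℕ) (d : ℕ) (c : ℕ → ℕ → ℚ) : Prop :=
  ∀ o p, ∃ z : ℤ, (d : ℚ) ^ (K - 1 - o) * c o p = z

/-- The datum with the single entry `X` at order `o₀ + 1`, pole `p₀`. [folklore] -/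
def single (o₀ p₀ : ℕ) (X : ℚ) : ℕ → ℕ → ℚ := fun o p => if o = o₀ ∧ p = p₀ then X else 0

/-- `pfEval` is additive in the data. [folklore] -/
theorem pfEval_add (n K : ℕ) (c₁ c₂ : ℕ → ℕ → ℚ) (t : ℚ) :
    pfEval n K (c₁ + c₂) t = pfEval n K c₁ t + pfEval n K c₂ t := by
  simp only [pfEval, Pi.add_apply, add_div, sum_add_distrib]

/-- `pfEval` commutes with finite sums of data. [folklore] -/
theorem pfEval_sum {ι : Type*} (s : Finset ι) (n K : ℕ) (f : ι → ℕ → ℕ → ℚ) (t : ℚ) :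
    pfEval n K (∑ x ∈ s, f x) t = ∑ x ∈ s, pfEval n K (f x) t := by
  classical
  induction s using Finset.induction_on with
  | empty => simp [pfEval]
  | insert a s ha ih => rw [sum_insert ha, pfEval_add, ih, sum_insert ha]

/-- `pfEval` of a single entry inside the support. [folklore] -/
theorem pfEval_single (n K o₀ p₀ : ℕ) (X : ℚ) (ho : o₀ < K) (hp : p₀ ≤ n) (t : ℚ) :
    pfEval n K (single o₀ p₀ X) t = X / (t + p₀ + 1) ^ (o₀ + 1) := by
  unfold pfEval single
  rw [sum_eq_single p₀]
  · rw [sum_eq_single o₀]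
    · simp
    · intro o _ hne
      simp [hne]
    · intro h
      exact absurd (mem_range.2 ho) h
  · intro p _ hne
    refine sum_eq_zero fun o _ => ?_
    simp [hne]
  · intro h
    exact absurd (mem_range.2 (Nat.lt_succ_of_le hp)) h

/-- `l1` is subadditive. [folklore] -/
theorem l1_add_le (n K : ℕ) (c₁ c₂ : ℕ → ℕ → ℚ) :
    l1 n K (c₁ + c₂) ≤ l1 n K c₁ + l1 n K c₂ := by
  simp only [l1, Pi.add_apply, ← sum_add_distrib]
  exact sum_le_sum fun p _ => sum_le_sum fun o _ => abs_add_le _ _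

/-- `l1` of a finite sum of data. [folklore] -/
theorem l1_sum_le {ι : Type*} (s : Finset ι) (n K : ℕ) (f : ι → ℕ → ℕ → ℚ) :
    l1 n K (∑ x ∈ s, f x) ≤ ∑ x ∈ s, l1 n K (f x) := by
  classical
  induction s using Finset.induction_on with
  | empty => simp [l1]
  | insert a s ha ih =>
    rw [sum_insert ha, sum_insert ha]
    exact (l1_add_le _ _ _ _).trans (by linarith)

/-- `l1` of a single entry. [folklore] -/
theorem l1_single_le (n K o₀ p₀ : ℕ) (X : ℚ) : l1 n K (single o₀ p₀ X) ≤ |X| := by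
  unfold l1 single
  by_cases hp : p₀ ∈ range (n + 1)
  · rw [sum_eq_single p₀]
    · by_cases ho : o₀ ∈ range K
      · rw [sum_eq_single o₀]
        · simp
        · intro o _ hne
          simp [hne]
        · intro h
          exact absurd ho h
      · rw [sum_eq_zero]
        · exact abs_nonneg _
        · intro o ho'
          have : o ≠ o₀ := fun h => ho (h ▸ ho')
          simp [this]
    · intro p _ hne
      exact sum_eq_zero fun o _ => by simp [hne]
    · intro h
      exact absurd hp h
  · rw [sum_eq_zero]
    · exact abs_nonneg _
    · intro p hp'
      have : p ≠ p₀ := fun h => hp (h ▸ hp')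
      exact sum_eq_zero fun o _ => by simp [this]

/-- `IsInt` is additive. [folklore] -/
theorem IsInt.add {K d : ℕ} {c₁ c₂ : ℕ → ℕ → ℚ} (h₁ : IsInt K d c₁) (h₂ : IsInt K d c₂) :
    IsInt K d (c₁ + c₂) := by
  intro o p
  obtain ⟨z₁, hz₁⟩ := h₁ o p
  obtain ⟨z₂, hz₂⟩ := h₂ o p
  refine ⟨z₁ + z₂, ?_⟩
  simp only [Pi.add_apply]
  rw [mul_add, hz₁, hz₂]
  push_cast
  ring

/-- `IsInt` is closed under finite sums. [folklore] -/
theorem IsInt.sum {ι : Type*} {K d : ℕ} (s : Finset ι) {f : ι → ℕ → ℕ → ℚ}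
    (h : ∀ x ∈ s, IsInt K d (f x)) : IsInt K d (∑ x ∈ s, f x) := by
  classical
  induction s using Finset.induction_on with
  | empty => exact fun o p => ⟨0, by simp⟩
  | insert a s ha ih =>
    rw [sum_insert ha]
    exact (h a (mem_insert_self a s)).add (ih fun x hx => h x (mem_insert_of_mem hx))

/-- `IsInt` for a single entry. [folklore] -/
theorem isInt_single {K d : ℕ} (o₀ p₀ : ℕ) {X : ℚ}
    (h : ∃ z : ℤ, (d : ℚ) ^ (K - 1 - o₀) * X = z) : IsInt K d (single o₀ p₀ X) := by
  intro o p
  unfold single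
  by_cases hc : o = o₀ ∧ p = p₀
  · rw [if_pos hc, hc.1]
    exact h
  · exact ⟨0, by rw [if_neg hc]; simp⟩

/-! ### The algebraic input: `1/(x^{i+1}(x+δ))` in partial fractions -/

/-- For `x, x + δ, δ ≠ 0`:
`1/(x^{i+1}(x+δ)) = ∑_{o ≤ i} (-1)^{i-o}/(δ^{i-o+1} x^{o+1}) + (-1)^{i+1}/(δ^{i+1}(x+δ))`.
[folklore] -/
theorem basic_identity (x δ : ℚ) (hx : x ≠ 0) (hxδ : x + δ ≠ 0) (hδ : δ ≠ 0) (i : ℕ) :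
    1 / (x ^ (i + 1) * (x + δ)) =
      ∑ o ∈ range (i + 1), (-1 : ℚ) ^ (i - o) / (δ ^ (i - o + 1) * x ^ (o + 1)) +
        (-1 : ℚ) ^ (i + 1) / (δ ^ (i + 1) * (x + δ)) := by
  induction i with
  | zero =>
    simp only [zero_add, pow_one, range_one, sum_singleton, Nat.sub_zero, pow_zero, one_div]
    field_simp
    ring
  | succ i ih =>
    have hstep : 1 / (x ^ (i + 1 + 1) * (x + δ)) = x⁻¹ * (1 / (x ^ (i + 1) * (x + δ))) := by
      field_simp
      ring
    rw [hstep, ih, mul_add, mul_sum, sum_range_succ' _ (i + 1)]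
    simp only [Nat.succ_sub_succ_eq_sub, Nat.sub_zero]
    have hterm : ∀ o ∈ range (i + 1), x⁻¹ * ((-1 : ℚ) ^ (i - o) / (δ ^ (i - o + 1) * x ^ (o + 1)))
        = (-1 : ℚ) ^ (i - o) / (δ ^ (i - o + 1) * x ^ (o + 1 + 1)) := by
      intro o _
      field_simp
      ring
    rw [sum_congr rfl hterm]
    have hlast : x⁻¹ * ((-1 : ℚ) ^ (i + 1) / (δ ^ (i + 1) * (x + δ))) =
        (-1 : ℚ) ^ (i + 1) / (δ ^ (i + 1 + 1) * x ^ (0 + 1)) +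
          (-1 : ℚ) ^ (i + 1 + 1) / (δ ^ (i + 1 + 1) * (x + δ)) := by
      field_simp
      ring
    rw [hlast]
    ring

/-! ### One multiplication step -/

/-- Contribution of the term `c/(t+j+1)^{i+1}` times the simple fraction `A/(t+m+1)`:
if `m = j` the single entry `cA` at order `i+2`, pole `j`; if `m ≠ j` the entries given by
`basic_identity` with `x = t+j+1`, `δ = m-j`. [folklore] -/
def contrib (c : ℚ) (A : ℤ) (i j m : ℕ) : ℕ → ℕ → ℚ :=
  if m = j then single (i + 1) j (c * A)
  else (∑ o ∈ range (i + 1),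
      single o j (c * A * (-1) ^ (i - o) / ((m : ℚ) - j) ^ (i - o + 1))) +
    single 0 m (c * A * (-1) ^ (i + 1) / ((m : ℚ) - j) ^ (i + 1))

/-- Evaluation of a contribution: `c A / ((t+j+1)^{i+1} (t+m+1))`. [folklore] -/
theorem pfEval_contrib (n K : ℕ) (c : ℚ) (A : ℤ) {i j m : ℕ} (hi : i < K) (hj : j ≤ n)
    (hm : m ≤ n) (t : ℚ) (ht : ∀ p, p ≤ n → t + p + 1 ≠ 0) :
    pfEval n (K + 1) (contrib c A i j m) t = c * A / ((t + j + 1) ^ (i + 1) * (t + m + 1)) := by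
  unfold contrib
  by_cases hmj : m = j
  · rw [if_pos hmj, pfEval_single _ _ _ _ _ (by omega) hj, hmj]
    ring
  · rw [if_neg hmj, pfEval_add, pfEval_sum, pfEval_single _ _ _ _ _ (by omega) hm]
    have hδ : (m : ℚ) - j ≠ 0 := by
      intro h
      apply hmj
      exact_mod_cast (sub_eq_zero.1 h)
    have hx : t + j + 1 ≠ 0 := ht j hj
    have hxδ : t + j + 1 + ((m : ℚ) - j) ≠ 0 := by
      have := ht m hm
      intro h
      apply this
      linarith
    have hb := basic_identity (t + j + 1) ((m : ℚ) - j) hx hxδ hδ i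
    have hsum : ∑ x ∈ range (i + 1), pfEval n (K + 1)
        (single x j (c * A * (-1) ^ (i - x) / ((m : ℚ) - j) ^ (i - x + 1))) t =
        ∑ o ∈ range (i + 1), c * A * ((-1 : ℚ) ^ (i - o) / (((m : ℚ) - j) ^ (i - o + 1) *
          (t + j + 1) ^ (o + 1))) := by
      refine sum_congr rfl fun o ho => ?_
      rw [pfEval_single _ _ _ _ _ (by have := mem_range.1 ho; omega) hj]
      field_simp
    rw [hsum, ← mul_sum]
    have hS : ∑ o ∈ range (i + 1), (-1 : ℚ) ^ (i - o) /
        (((m : ℚ) - j) ^ (i - o + 1) * (t + j + 1) ^ (o + 1)) =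
        1 / ((t + j + 1) ^ (i + 1) * (t + j + 1 + ((m : ℚ) - j))) -
          (-1 : ℚ) ^ (i + 1) / (((m : ℚ) - j) ^ (i + 1) * (t + j + 1 + ((m : ℚ) - j))) := by
      rw [hb]
      ring
    have hm' : t + m + 1 = t + j + 1 + ((m : ℚ) - j) := by ring
    rw [hS, hm']
    field_simp
    ring

/-- Integrality of a contribution. [folklore] -/
theorem isInt_contrib {K d : ℕ} (n : ℕ)
    (hdiv : ∀ k : ℕ, 1 ≤ k → k ≤ n → (k : ℤ) ∣ d) (c : ℚ) (A : ℤ) {i j m : ℕ}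
    (hi : i < K) (hj : j ≤ n) (hm : m ≤ n) (hc : ∃ z : ℤ, (d : ℚ) ^ (K - 1 - i) * c = z) :
    IsInt (K + 1) d (contrib c A i j m) := by
  obtain ⟨z, hz⟩ := hc
  unfold contrib
  by_cases hmj : m = j
  · rw [if_pos hmj]
    refine isInt_single _ _ ⟨z * A, ?_⟩
    have : K + 1 - 1 - (i + 1) = K - 1 - i := by omega
    rw [this, ← mul_assoc, hz]
    push_cast
    ring
  · rw [if_neg hmj]
    -- `(m - j) ∣ d`, hence `d / (m - j)` is an integer `w`
    obtain ⟨w, hw⟩ : ∃ w : ℤ, (d : ℤ) = ((m : ℤ) - j) * w := by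
      have h1 : ((Int.natAbs ((m : ℤ) - j) : ℕ) : ℤ) ∣ d := by
        apply hdiv
        · omega
        · omega
      rw [Int.natCast_natAbs, abs_dvd] at h1
      exact h1
    have hδ : ((m : ℚ) - j) ≠ 0 := by
      intro h
      apply hmj
      exact_mod_cast (sub_eq_zero.1 h)
    have hwq : (d : ℚ) = ((m : ℚ) - j) * w := by exact_mod_cast hw
    have hpow : ∀ e : ℕ, (d : ℚ) ^ e / ((m : ℚ) - j) ^ e = (w : ℚ) ^ e := by
      intro e
      rw [hwq, mul_pow, mul_div_cancel_left₀ _ (pow_ne_zero _ hδ)]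
    refine IsInt.add (IsInt.sum _ fun o ho => ?_) ?_
    · have ho' : o ≤ i := Nat.lt_succ_iff.1 (mem_range.1 ho)
      refine isInt_single _ _ ⟨z * A * (-1) ^ (i - o) * w ^ (i - o + 1), ?_⟩
      have he : K + 1 - 1 - o = (K - 1 - i) + (i - o + 1) := by omega
      rw [he, pow_add]
      calc (d : ℚ) ^ (K - 1 - i) * (d : ℚ) ^ (i - o + 1) *
            (c * A * (-1) ^ (i - o) / ((m : ℚ) - j) ^ (i - o + 1))
          = ((d : ℚ) ^ (K - 1 - i) * c) * A * (-1) ^ (i - o) *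
              ((d : ℚ) ^ (i - o + 1) / ((m : ℚ) - j) ^ (i - o + 1)) := by ring
        _ = _ := by rw [hz, hpow]; push_cast; ring
    · refine isInt_single _ _ ⟨z * A * (-1) ^ (i + 1) * w ^ (i + 1), ?_⟩
      have he : K + 1 - 1 - 0 = (K - 1 - i) + (i + 1) := by omega
      rw [he, pow_add]
      calc (d : ℚ) ^ (K - 1 - i) * (d : ℚ) ^ (i + 1) *
            (c * A * (-1) ^ (i + 1) / ((m : ℚ) - j) ^ (i + 1))
          = ((d : ℚ) ^ (K - 1 - i) * c) * A * (-1) ^ (i + 1) *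
              ((d : ℚ) ^ (i + 1) / ((m : ℚ) - j) ^ (i + 1)) := by ring
        _ = _ := by rw [hz, hpow]; push_cast; ring

/-- `ℓ¹`-size of a contribution: `≤ (i+2) |c| |A|`. [folklore] -/
theorem l1_contrib_le (n K : ℕ) (c : ℚ) (A : ℤ) (i j m : ℕ) :
    l1 n (K + 1) (contrib c A i j m) ≤ (i + 2) * (|c| * |(A : ℚ)|) := by
  have h0 : 0 ≤ |c| * |(A : ℚ)| := by positivity
  unfold contrib
  by_cases hmj : m = j
  · rw [if_pos hmj]
    calc l1 n (K + 1) (single (i + 1) j (c * A)) ≤ |c * A| := l1_single_le _ _ _ _ _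
      _ = |c| * |(A : ℚ)| := abs_mul _ _
      _ ≤ (i + 2) * (|c| * |(A : ℚ)|) := by nlinarith
  · rw [if_neg hmj]
    have hδ1 : 1 ≤ |((m : ℚ) - j)| := by
      have : (1 : ℤ) ≤ |(m : ℤ) - j| := Int.one_le_abs (by omega)
      have h' : ((1 : ℤ) : ℚ) ≤ ((|(m : ℤ) - j| : ℤ) : ℚ) := by exact_mod_cast this
      simpa [Int.cast_abs] using h'
    have hpow : ∀ e e' : ℕ, |c * A * (-1) ^ e' / ((m : ℚ) - j) ^ e| ≤ |c| * |(A : ℚ)| := by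
      intro e e'
      rw [abs_div, abs_mul, abs_mul, abs_pow, abs_pow, abs_neg, abs_one, one_pow, mul_one]
      exact div_le_self h0 (one_le_pow₀ hδ1)
    refine (l1_add_le _ _ _ _).trans ?_
    have h1 : l1 n (K + 1) (∑ o ∈ range (i + 1),
        single o j (c * A * (-1) ^ (i - o) / ((m : ℚ) - j) ^ (i - o + 1))) ≤
        (i + 1) * (|c| * |(A : ℚ)|) := by
      refine (l1_sum_le _ _ _ _).trans ?_
      calc ∑ o ∈ range (i + 1), l1 n (K + 1)
            (single o j (c * A * (-1) ^ (i - o) / ((m : ℚ) - j) ^ (i - o + 1)))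
          ≤ ∑ _o ∈ range (i + 1), |c| * |(A : ℚ)| :=
            sum_le_sum fun o _ => (l1_single_le _ _ _ _ _).trans (hpow _ _)
        _ = (i + 1) * (|c| * |(A : ℚ)|) := by simp
    have h2 : l1 n (K + 1) (single 0 m (c * A * (-1) ^ (i + 1) / ((m : ℚ) - j) ^ (i + 1))) ≤
        |c| * |(A : ℚ)| := (l1_single_le _ _ _ _ _).trans (hpow _ _)
    linarith

/-- **The multiplication step.** If `c` expands `F` with `K ≥ 1` orders, then
`c' = ∑_{o<K, j ≤ n, m ≤ n} contrib (c o j) (A m) o j m` expands `F · B_A` with `K + 1`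
orders, stays integral, and `‖c'‖₁ ≤ (K+1) ‖c‖₁ ∑ |A_m|`. [folklore] -/
theorem step (n K d : ℕ) (hdiv : ∀ k : ℕ, 1 ≤ k → k ≤ n → (k : ℤ) ∣ d)
    (c : ℕ → ℕ → ℚ) (A : ℕ → ℤ) (F : ℚ → ℚ)
    (heval : ∀ t : ℚ, (∀ p, p ≤ n → t + p + 1 ≠ 0) → pfEval n K c t = F t)
    (hint : IsInt K d c) :
    ∃ c' : ℕ → ℕ → ℚ,
      (∀ t : ℚ, (∀ p, p ≤ n → t + p + 1 ≠ 0) →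
        pfEval n (K + 1) c' t = F t * brickEval n A t) ∧
      IsInt (K + 1) d c' ∧
      l1 n (K + 1) c' ≤ (K + 1) * l1 n K c * ∑ m ∈ range (n + 1), |(A m : ℚ)| := by
  refine ⟨∑ o ∈ range K, ∑ j ∈ range (n + 1), ∑ m ∈ range (n + 1),
    contrib (c o j) (A m) o j m, ?_, ?_, ?_⟩
  · intro t ht
    rw [pfEval_sum, ← heval t ht]
    simp only [pfEval_sum]
    have h1 : ∀ o ∈ range K, ∀ j ∈ range (n + 1), ∀ m ∈ range (n + 1),
        pfEval n (K + 1) (contrib (c o j) (A m) o j m) t =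
          c o j / (t + j + 1) ^ (o + 1) * ((A m : ℚ) / (t + m + 1)) := by
      intro o ho j hj m hm
      rw [pfEval_contrib n K (c o j) (A m) (mem_range.1 ho) (Nat.lt_succ_iff.1 (mem_range.1 hj))
        (Nat.lt_succ_iff.1 (mem_range.1 hm)) t ht]
      have := ht j (Nat.lt_succ_iff.1 (mem_range.1 hj))
      have := ht m (Nat.lt_succ_iff.1 (mem_range.1 hm))
      field_simp
    rw [sum_congr rfl fun o ho => sum_congr rfl fun j hj => sum_congr rfl fun m hm => h1 o ho j hj m hm]
    unfold pfEval brickEval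
    rw [sum_comm, sum_mul]
    refine sum_congr rfl fun j _ => ?_
    rw [sum_mul]
    refine sum_congr rfl fun o _ => ?_
    rw [mul_sum]
  · refine IsInt.sum _ fun o ho => IsInt.sum _ fun j hj => IsInt.sum _ fun m hm => ?_
    exact isInt_contrib n hdiv (c o j) (A m) (mem_range.1 ho)
      (Nat.lt_succ_iff.1 (mem_range.1 hj)) (Nat.lt_succ_iff.1 (mem_range.1 hm)) (hint o j)
  · have hA0 : 0 ≤ ∑ m ∈ range (n + 1), |(A m : ℚ)| := sum_nonneg fun _ _ => abs_nonneg _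
    calc l1 n (K + 1) (∑ o ∈ range K, ∑ j ∈ range (n + 1), ∑ m ∈ range (n + 1),
          contrib (c o j) (A m) o j m)
        ≤ ∑ o ∈ range K, ∑ j ∈ range (n + 1), ∑ m ∈ range (n + 1),
            l1 n (K + 1) (contrib (c o j) (A m) o j m) := by
          refine (l1_sum_le _ _ _ _).trans (sum_le_sum fun o _ => ?_)
          refine (l1_sum_le _ _ _ _).trans (sum_le_sum fun j _ => ?_)
          exact l1_sum_le _ _ _ _
      _ ≤ ∑ o ∈ range K, ∑ j ∈ range (n + 1), ∑ m ∈ range (n + 1),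
            (K + 1) * (|c o j| * |(A m : ℚ)|) := by
          refine sum_le_sum fun o ho => sum_le_sum fun j _ => sum_le_sum fun m _ => ?_
          refine (l1_contrib_le _ _ _ _ _ _ _).trans ?_
          have : (o : ℚ) + 2 ≤ K + 1 := by
            have := mem_range.1 ho
            exact_mod_cast (by omega : o + 2 ≤ K + 1)
          exact mul_le_mul_of_nonneg_right this (by positivity)
      _ = (K + 1) * l1 n K c * ∑ m ∈ range (n + 1), |(A m : ℚ)| := by
          have h2 : ∀ o j, ∑ m ∈ range (n + 1), ((K : ℚ) + 1) * (|c o j| * |(A m : ℚ)|) =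
              ((K : ℚ) + 1) * |c o j| * ∑ m ∈ range (n + 1), |(A m : ℚ)| := by
            intro o j
            rw [mul_sum]
            exact sum_congr rfl fun m _ => by ring
          simp_rw [h2, ← sum_mul, ← mul_sum]
          unfold l1
          conv_lhs => rw [sum_comm]

/-! ### Products of bricks -/

/-- **Partial fractions of a product of `K ≥ 1` bricks.** For bricks with integer residues
`A^{(s)}_m` (`s < K`) and any common multiple `d` of `1, …, n` there are coefficients `c_{o,p}`
with `∏_{s<K} B_s(t) = ∑_{p ≤ n} ∑_{o < K} c_{o,p}/(t+p+1)^{o+1}` away from the poles,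
`d^{K-1-o} c_{o,p} ∈ ℤ`, and `∑ |c_{o,p}| ≤ K! ∏_{s<K} ∑_m |A^{(s)}_m|`. This is the mechanism
of [Rivoal2000, Lemme 5] ("en décomposant `F_l`, `G_l` et `H` en fractions partielles … grâce à
la formule de Leibniz"), with the size bound made explicit. [folklore] -/
theorem exists_pf_prod (n d : ℕ) (hdiv : ∀ k : ℕ, 1 ≤ k → k ≤ n → (k : ℤ) ∣ d)
    (A : ℕ → ℕ → ℤ) (K : ℕ) (hK : 1 ≤ K) :
    ∃ c : ℕ → ℕ → ℚ,
      (∀ t : ℚ, (∀ p, p ≤ n → t + p + 1 ≠ 0) →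
        pfEval n K c t = ∏ s ∈ range K, brickEval n (A s) t) ∧
      IsInt K d c ∧
      l1 n K c ≤ (K.factorial : ℚ) * ∏ s ∈ range K, ∑ m ∈ range (n + 1), |(A s m : ℚ)| := by
  induction K, hK using Nat.le_induction with
  | base =>
    refine ⟨fun o p => if o = 0 then (A 0 p : ℚ) else 0, ?_, ?_, ?_⟩
    · intro t _
      simp [pfEval, brickEval]
    · intro o p
      by_cases ho : o = 0
      · exact ⟨A 0 p, by simp [ho]⟩
      · exact ⟨0, by simp [ho]⟩
    · simp [l1]
  | succ K hK ih =>
    obtain ⟨c, hc, hint, hl1⟩ := ih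
    obtain ⟨c', hc', hint', hl1'⟩ := step n K d hdiv c (A K) _ hc hint
    refine ⟨c', fun t ht => by rw [hc' t ht, prod_range_succ], hint', hl1'.trans ?_⟩
    rw [prod_range_succ, Nat.factorial_succ]
    push_cast
    have h0 : 0 ≤ ∑ m ∈ range (n + 1), |(A K m : ℚ)| := sum_nonneg fun _ _ => abs_nonneg _
    have h1 : (0 : ℚ) ≤ K + 1 := by positivity
    calc (K + 1 : ℚ) * l1 n K c * ∑ m ∈ range (n + 1), |(A K m : ℚ)|
        ≤ (K + 1) * ((K.factorial : ℚ) * ∏ s ∈ range K, ∑ m ∈ range (n + 1), |(A s m : ℚ)|) *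
            ∑ m ∈ range (n + 1), |(A K m : ℚ)| := by gcongr
      _ = _ := by ring

end BallRivoal

end Literature.NumberTheory.Transcendental
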